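import Mathlib
import Literature.AlgebraicGeometry.Resolution.TranscendentallyImmediate
import Literature.AlgebraicGeometry.Resolution.AffineDomainEquidim
import Literature.AlgebraicGeometry.Resolution.AffineDomainDimension
import HarnessLib

/-!
# The shadow's local ring is regular (`stub_shadowLocalRing_regular`)

Stub of the birth line of the crux `ShadowsUniformize` (route `AbhyankarShadows`).

Setting: `k ⊆ L` fields, `O'` a valuation subring of `L` which is RATIONAL over `k` (every
element of `O'` is congruent to a constant of `k` modulo `𝔪_{O'}`), `C ⊆ O'` a finitely generated
`k`-subalgebra of `L`, `𝔭' = 𝔪_{O'} ∩ C` the centre of `O'` on `C`, `D = C_{𝔭'}` the shadow's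
local ring; `y₁, …, y_r ∈ C` value-independent elements (their values in `Γ_{O'}` are
`ℤ`-independent) whose images generate `𝔪_D`.

Claim: `D` is a regular local ring.

Proof. (a) `𝔭'` is a maximal ideal: the composite `C → O' → O'/𝔪_{O'}` is onto, because every
residue is the residue of a constant and `k ⊆ C`; its kernel is `𝔭'`. (b) `C` is a domain of
finite type over `k`, so `dim D = dim C = trdeg_k C`
(`ringKrullDim_localization_atPrime_eq_of_isMaximal`, `exists_ringKrullDim_eq_and_trdeg_eq`).
(c) Value-independent elements are algebraically independent over `k` (the constants have value
`1`; ultrametric inequality: `algebraicIndependent_of_valuation`), so `r ≤ trdeg_k C`.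
(d) `𝔪_D` is generated by `r ≤ dim D` elements, hence `D` is regular
(`IsRegularLocalRing.of_spanFinrank_maximalIdeal_le`).
-/

-- single-problem summit: the doubled namespace component is forced
set_option linter.dupNamespace false

open IsLocalRing Literature.AlgebraicGeometry.Resolution

namespace Summit.ResolutionOfSingularities.ResolutionOfSingularities.Theorems

universe u

/-- **Regularity by counting generators against the transcendence degree.** Let `A` be a domain
of finite type over a field `k`, `𝔪` a maximal ideal of `A` and `x₁, …, x_r ∈ A` algebraically
independent over `k` whose images generate the maximal ideal of `A_𝔪`. Then `A_𝔪` is a regular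
local ring: `𝔪 A_𝔪` needs at most `r` generators, while
`dim A_𝔪 = dim A = trdeg_k A ≥ r`. [cite: Matsumura1987, Thm. 5.6] -/
theorem shadowLocalRing_isRegularLocalRing_of_algebraicIndependent (k : Type u) {A : Type u}
    [Field k] [CommRing A] [IsDomain A] [Algebra k A] [Algebra.FiniteType k A] (m : Ideal A)
    [m.IsMaximal] {r : ℕ} (x : Fin r → A) (hx : AlgebraicIndependent k x)
    (hspan : maximalIdeal (Localization.AtPrime m) =
      Ideal.span (Set.range fun i => algebraMap A (Localization.AtPrime m) (x i))) :
    IsRegularLocalRing (Localization.AtPrime m) := by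
  haveI : IsNoetherianRing A := Algebra.FiniteType.isNoetherianRing k A
  haveI : IsNoetherianRing (Localization.AtPrime m) :=
    IsLocalization.isNoetherianRing m.primeCompl _ inferInstance
  -- `dim A_𝔪 = dim A = trdeg_k A = n ≥ r`
  obtain ⟨n, hdimA, htr⟩ := exists_ringKrullDim_eq_and_trdeg_eq k A
  have hdim : ringKrullDim (Localization.AtPrime m) = n := by
    rw [ringKrullDim_localization_atPrime_eq_of_isMaximal k m, hdimA]
  have hrn : r ≤ n := by
    have h := hx.lift_cardinalMk_le_trdeg
    rw [Cardinal.mk_fin, htr, Cardinal.lift_natCast, Cardinal.lift_natCast] at h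
    exact_mod_cast h
  -- `𝔪 A_𝔪` needs at most `r` generators
  have hgen : (maximalIdeal (Localization.AtPrime m)).spanFinrank ≤ r := by
    rw [hspan]
    refine (Submodule.spanFinrank_span_le_ncard_of_finite (Set.finite_range _)).trans ?_
    rw [← Set.image_univ]
    refine (Set.ncard_image_le Set.finite_univ).trans ?_
    rw [Set.ncard_univ, Nat.card_eq_fintype_card, Fintype.card_fin]
  refine IsRegularLocalRing.of_spanFinrank_maximalIdeal_le _ ?_
  rw [hdim]
  exact_mod_cast hgen.trans hrn

/-- **The centre of a rational valuation ring is a closed `k`-point.** If every element of the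
valuation ring `O'` of `L` is congruent to a constant of `k` modulo `𝔪_{O'}`, then for every
`k`-subalgebra `C ⊆ O'` the centre `𝔪_{O'} ∩ C` is a maximal ideal of `C`: the composite
`C → O' → O'/𝔪_{O'}` is onto (`k ⊆ C`) with kernel the centre. [folklore] -/
theorem shadowLocalRing_centre_isMaximal {k L : Type*} [Field k] [Field L] [Algebra k L]
    (O' : ValuationSubring L) (C : Subalgebra k L) (hC : C.toSubring ≤ O'.toSubring)
    (hrat : ∀ z : L, z ∈ O' → ∃ c : k, O'.valuation (z - algebraMap k L c) < 1) :
    (Ideal.comap (Subring.inclusion hC) (maximalIdeal O')).IsMaximal := by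
  have hsurj : Function.Surjective ((residue O').comp (Subring.inclusion hC)) := by
    intro q
    obtain ⟨z, rfl⟩ := residue_surjective q
    obtain ⟨c, hc⟩ := hrat z z.2
    refine ⟨⟨algebraMap k L c, C.algebraMap_mem c⟩, ?_⟩
    rw [RingHom.comp_apply, ← sub_eq_zero, ← map_sub, residue_eq_zero_iff,
      ValuationSubring.valuation_lt_one_iff]
    have h : ((Subring.inclusion hC ⟨algebraMap k L c, C.algebraMap_mem c⟩ - z : O') : L) =
        algebraMap k L c - z := rfl
    rw [h, Valuation.map_sub_swap]
    exact hc
  have hmax := RingHom.ker_isMaximal_of_surjective _ hsurj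
  rwa [← RingHom.comap_ker, ker_residue] at hmax

/-- **Constants are units of a valuation ring containing them**: if `k ⊆ C ⊆ O'` then every
non-zero element of the bottom subalgebra `k ⊆ L` has value `1`. [folklore] -/
theorem shadowLocalRing_valuation_eq_one_of_mem_bot {k L : Type*} [Field k] [Field L]
    [Algebra k L] (O' : ValuationSubring L) (C : Subalgebra k L)
    (hC : C.toSubring ≤ O'.toSubring) :
    ∀ x ∈ (⊥ : Subalgebra k L), x ≠ 0 → O'.valuation x = 1 := by
  intro x hx hx0
  obtain ⟨c, rfl⟩ := Algebra.mem_bot.mp hx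
  rw [valuation_eq_one_iff_mem_and_inv_mem O' hx0, ← map_inv₀]
  exact ⟨hC (C.algebraMap_mem c), hC (C.algebraMap_mem c⁻¹)⟩

/-- **Value-independent elements of `C` are algebraically independent over `k`** (inside the
`k`-algebra `C`): the constants have value `1` and distinct monomials in a value-independent
family have distinct values (ultrametric inequality). [cite: KnafKuhlmann2005, Thm. 2.1] -/
theorem shadowLocalRing_algebraicIndependent {k L : Type*} [Field k] [Field L] [Algebra k L]
    (O' : ValuationSubring L) (C : Subalgebra k L) (hC : C.toSubring ≤ O'.toSubring) {r : ℕ}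
    (y : Fin r → L) (hy : ∀ i, y i ∈ C) (hvi : IsValueIndependent O' y) :
    AlgebraicIndependent k fun i => (⟨y i, hy i⟩ : C) := by
  have hbot : AlgebraicIndependent (⊥ : Subalgebra k L) y :=
    algebraicIndependent_of_valuation O' (⊥ : Subalgebra k L)
      (shadowLocalRing_valuation_eq_one_of_mem_bot O' C hC) y (hvi.injective_prod_pow O')
  have hinj : Function.Injective (algebraMap k (⊥ : Subalgebra k L)) :=
    (algebraMap k (⊥ : Subalgebra k L)).injective
  have hk : AlgebraicIndependent k y := hbot.restrictScalars hinj
  exact AlgebraicIndependent.of_comp C.val hk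

/-- **The shadow's local ring is regular.** With `O'` a rational valuation ring of `L` over `k`,
`C ⊆ O'` a finitely generated `k`-subalgebra, `𝔭' = 𝔪_{O'} ∩ C` and `D = C_{𝔭'}`: if `𝔪_D` is
generated by the images of `r` value-independent elements `y₁, …, y_r ∈ C`, then `D` is a regular
local ring — `𝔭'` is a closed `k`-point, so `dim D = dim C = trdeg_k C ≥ r` (the `y_i` are
algebraically independent over `k`), while `𝔪_D` needs at most `r` generators.
[cite: KnafKuhlmann2005, Thm. 2.1; Matsumura1987, Thm. 5.6] -/
theorem stub_shadowLocalRing_regular (k L : Type) [Field k] [Field L] [Algebra k L]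
    (O' : ValuationSubring L) (C : Subalgebra k L) (hC : C.toSubring ≤ O'.toSubring) (hCfg : C.FG)
    (hrat : ∀ z : L, z ∈ O' → ∃ c : k, O'.valuation (z - algebraMap k L c) < 1) (r : ℕ)
    (y : Fin r → L) (hy : ∀ i, y i ∈ C) (hvi : IsValueIndependent O' y)
    (hspan : IsLocalRing.maximalIdeal (Localization.AtPrime (Ideal.comap (Subring.inclusion hC)
        (IsLocalRing.maximalIdeal O'))) =
      Ideal.span (Set.range fun i => algebraMap C.toSubring (Localization.AtPrime
        (Ideal.comap (Subring.inclusion hC) (IsLocalRing.maximalIdeal O'))) ⟨y i, hy i⟩)) :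
    IsRegularLocalRing (Localization.AtPrime (Ideal.comap (Subring.inclusion hC)
      (IsLocalRing.maximalIdeal O'))) := by
  haveI := shadowLocalRing_centre_isMaximal O' C hC hrat
  haveI : Algebra.FiniteType k C := C.fg_iff_finiteType.mp hCfg
  exact shadowLocalRing_isRegularLocalRing_of_algebraicIndependent k
    (A := C) (Ideal.comap (Subring.inclusion hC) (IsLocalRing.maximalIdeal O'))
    (fun i => (⟨y i, hy i⟩ : C)) (shadowLocalRing_algebraicIndependent O' C hC y hy hvi) hspan

end Summit.ResolutionOfSingularities.ResolutionOfSingularities.Theorems
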